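import Summits.KontsevichZagierPeriods.KontsevichZagierPeriods.Theorems.SoloBlindCyclicForm
import HarnessLib

/-!
# The two-exponent form `z^α (1-z)^β dz` on the half-plane, III: absolute integrability of `h`

For `-1 < α ≤ 0`, `-1 ≤ β ≤ 0`, `α + β < -1` the surface integrand `h = Re g_{αβ}'` of the
Green identity is absolutely integrable on `D = {x < ½, y > 0}`:
`|g_{αβ}'(z)| ≤ |z|^{α-1}|1-z|^β + |z|^α |1-z|^{β-1} ≤ prof₂(‖(x,y)‖_∞)` with the radial profile
`prof₂(r) = 6 r^{α-1}` (`r ≤ 1`), `6 r^{α+β-1}` (`r > 1`), which is integrable in the plane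
(polar coordinates in the sup norm), exactly as in `SoloBlindCauchyIntegrable`.

References: Kontsevich–Zagier, *Periods* (2001), §1.2.
-/

noncomputable section

open Set Complex MeasureTheory Filter
open scoped Topology
open Literature.NumberTheory.Transcendental
open Literature.NumberTheory.Transcendental.KZ

namespace Summit.KontsevichZagierPeriods.KontsevichZagierPeriods.Theorems

namespace SoloBlind

/-! ## Pointwise bounds -/

/-- `|z^{α-1}| = |z|^{α-1}` (complex exponent `α - 1`). -/
theorem norm_cpow_ofReal_sub_one (z : ℂ) (α : ℝ) : ‖z ^ ((α : ℂ) - 1)‖ = ‖z‖ ^ (α - 1) := by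
  rw [show (α : ℂ) - 1 = ((α - 1 : ℝ) : ℂ) by push_cast; ring, norm_cpow_real]

/-- A real number of `[-1, 0]`, as a complex scalar, has norm `≤ 1`. -/
theorem norm_ofReal_le_one {α : ℝ} (h1 : -1 ≤ α) (h0 : α ≤ 0) : ‖(α : ℂ)‖ ≤ 1 := by
  rw [norm_real, Real.norm_eq_abs, abs_le]
  exact ⟨by linarith, by linarith⟩

/-- **Pointwise bound**: `|g_{αβ}'(z)| ≤ |z|^{α-1}|1-z|^β + |z|^α|1-z|^{β-1}` for
`α, β ∈ [-1, 0]`. -/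
theorem norm_gTwoDer_le {α β : ℝ} (hα : -1 ≤ α) (hα0 : α ≤ 0) (hβ : -1 ≤ β) (hβ0 : β ≤ 0)
    (z : ℂ) : ‖gTwoDer α β z‖ ≤ ‖z‖ ^ (α - 1) * ‖1 - z‖ ^ β + ‖z‖ ^ α * ‖1 - z‖ ^ (β - 1) := by
  rw [gTwoDer]
  refine (norm_sub_le _ _).trans (add_le_add ?_ ?_)
  · rw [norm_mul, norm_mul, norm_cpow_ofReal_sub_one, norm_cpow_real]
    calc ‖(α : ℂ)‖ * ‖z‖ ^ (α - 1) * ‖1 - z‖ ^ β ≤ 1 * ‖z‖ ^ (α - 1) * ‖1 - z‖ ^ β :=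
          mul_le_mul_of_nonneg_right (mul_le_mul_of_nonneg_right (norm_ofReal_le_one hα hα0)
            (by positivity)) (by positivity)
      _ = _ := by ring
  · rw [norm_mul, norm_mul, norm_cpow_ofReal_sub_one, norm_cpow_real]
    calc ‖(β : ℂ)‖ * ‖z‖ ^ α * ‖1 - z‖ ^ (β - 1) ≤ 1 * ‖z‖ ^ α * ‖1 - z‖ ^ (β - 1) :=
          mul_le_mul_of_nonneg_right (mul_le_mul_of_nonneg_right (norm_ofReal_le_one hβ hβ0)
            (by positivity)) (by positivity)
      _ = _ := by ring

/-- `(½)^e ≤ 2` for `e ≥ -1`. -/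
theorem half_rpow_le_two {e : ℝ} (h1 : -1 ≤ e) : (1 / 2 : ℝ) ^ e ≤ 2 := by
  calc (1 / 2 : ℝ) ^ e = 2 ^ (-e) := by
        rw [one_div, Real.inv_rpow (by norm_num), Real.rpow_neg (by norm_num)]
    _ ≤ 2 ^ (1 : ℝ) := Real.rpow_le_rpow_of_exponent_le (by norm_num) (by linarith)
    _ = 2 := Real.rpow_one 2

/-- The dominating radial profile: `6 r^{α-1}` for `r ≤ 1`, `6 r^{α+β-1}` for `r > 1`. -/
def prof₂ (α β r : ℝ) : ℝ := 6 * (if r ≤ 1 then r ^ (α - 1) else r ^ (α + β - 1))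

/-- **Radial domination** in the sup norm: `|g_{αβ}'(x+iy)| ≤ prof₂(‖(x,y)‖)` on
`x < ½`, `y > 0`. -/
theorem norm_gTwoDer_le_prof₂ {α β : ℝ} (hα : -1 ≤ α) (hα0 : α ≤ 0) (hβ : -1 ≤ β) (hβ0 : β ≤ 0)
    {z : Fin 2 → ℝ} (hx : z 0 < 1 / 2) (hy : 0 < z 1) :
    ‖gTwoDer α β ((z 0 : ℂ) + z 1 * I)‖ ≤ prof₂ α β ‖z‖ := by
  set ζ : ℂ := (z 0 : ℂ) + z 1 * I with hζ
  have hre : ζ.re = z 0 := by simp [hζ]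
  have him : ζ.im = z 1 := by simp [hζ]
  have hζ0 : ζ ≠ 0 := by
    intro h
    have := congrArg Complex.im h
    rw [him, zero_im] at this
    exact hy.ne' this
  have hr0 : 0 < ‖z‖ :=
    lt_of_lt_of_le (by rw [Real.norm_eq_abs, abs_of_pos hy]; exact hy) (norm_le_pi_norm z 1)
  have hrz : ‖z‖ ≤ ‖ζ‖ := by
    refine (pi_norm_le_iff_of_nonneg (norm_nonneg ζ)).mpr fun i => ?_
    fin_cases i
    · simpa [hre, Real.norm_eq_abs] using abs_re_le_norm ζ
    · simpa [him, Real.norm_eq_abs] using abs_im_le_norm ζ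
  have hxζ : ζ.re < 1 / 2 := by rw [hre]; exact hx
  have hb := norm_gTwoDer_le hα hα0 hβ hβ0 ζ
  have h1z : ‖ζ‖ ≤ ‖1 - ζ‖ := norm_le_norm_one_sub hxζ
  have hhalf : 1 / 2 ≤ ‖1 - ζ‖ := half_le_norm_one_sub hxζ
  have hζpos : 0 < ‖ζ‖ := norm_pos_iff.mpr hζ0
  have hB1 : ‖1 - ζ‖ ^ β ≤ 2 :=
    (Real.rpow_le_rpow_of_nonpos (by norm_num) hhalf hβ0).trans (half_rpow_le_two hβ)
  have hB2 : ‖1 - ζ‖ ^ (β - 1) ≤ 4 := by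
    have h2 : (1 / 2 : ℝ) ^ (β - 1) = (1 / 2 : ℝ) ^ β * 2 := by
      rw [Real.rpow_sub (by norm_num), Real.rpow_one]; ring
    calc ‖1 - ζ‖ ^ (β - 1) ≤ (1 / 2 : ℝ) ^ (β - 1) :=
          Real.rpow_le_rpow_of_nonpos (by norm_num) hhalf (by linarith)
      _ ≤ 2 * 2 := by rw [h2]; nlinarith [half_rpow_le_two hβ]
      _ = 4 := by norm_num
  have hC1 : ‖1 - ζ‖ ^ β ≤ ‖ζ‖ ^ β := Real.rpow_le_rpow_of_nonpos hζpos h1z hβ0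
  have hC2 : ‖1 - ζ‖ ^ (β - 1) ≤ ‖ζ‖ ^ (β - 1) :=
    Real.rpow_le_rpow_of_nonpos hζpos h1z (by linarith)
  have hsum1 : ‖ζ‖ ^ (α - 1) * ‖ζ‖ ^ β = ‖ζ‖ ^ (α + β - 1) := by
    rw [← Real.rpow_add hζpos]; congr 1; ring
  have hsum2 : ‖ζ‖ ^ α * ‖ζ‖ ^ (β - 1) = ‖ζ‖ ^ (α + β - 1) := by
    rw [← Real.rpow_add hζpos]; congr 1; ring
  have hT : ‖gTwoDer α β ζ‖ ≤ ‖ζ‖ ^ (α + β - 1) + ‖ζ‖ ^ (α + β - 1) := by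
    calc ‖gTwoDer α β ζ‖ ≤ _ := hb
      _ ≤ ‖ζ‖ ^ (α - 1) * ‖ζ‖ ^ β + ‖ζ‖ ^ α * ‖ζ‖ ^ (β - 1) :=
          add_le_add (mul_le_mul_of_nonneg_left hC1 (by positivity))
            (mul_le_mul_of_nonneg_left hC2 (by positivity))
      _ = _ := by rw [hsum1, hsum2]
  rw [prof₂]
  split_ifs with hr
  · by_cases hζ1 : ‖ζ‖ ≤ 1
    · have hA : ‖ζ‖ ^ (α - 1) ≤ ‖z‖ ^ (α - 1) :=
        Real.rpow_le_rpow_of_nonpos hr0 hrz (by linarith)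
      have hA2 : ‖ζ‖ ^ α ≤ ‖z‖ ^ (α - 1) :=
        (Real.rpow_le_rpow_of_exponent_ge hζpos hζ1 (by linarith)).trans hA
      calc ‖gTwoDer α β ζ‖ ≤ _ := hb
        _ ≤ ‖z‖ ^ (α - 1) * 2 + ‖z‖ ^ (α - 1) * 4 :=
            add_le_add (mul_le_mul hA hB1 (by positivity) (by positivity))
              (mul_le_mul hA2 hB2 (by positivity) (by positivity))
        _ = 6 * ‖z‖ ^ (α - 1) := by ring
    · push Not at hζ1
      have hD : ‖ζ‖ ^ (α + β - 1) ≤ 1 :=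
        Real.rpow_le_one_of_one_le_of_nonpos hζ1.le (by linarith)
      have hone : 1 ≤ ‖z‖ ^ (α - 1) :=
        Real.one_le_rpow_of_pos_of_le_one_of_nonpos hr0 hr (by linarith)
      linarith
  · push Not at hr
    have hD : ‖ζ‖ ^ (α + β - 1) ≤ ‖z‖ ^ (α + β - 1) :=
      Real.rpow_le_rpow_of_nonpos hr0 hrz (by linarith)
    nlinarith [Real.rpow_nonneg hr0.le (α + β - 1)]

/-- The radial profile is integrable in the plane for `-1 < α`, `α + β < -1`. -/
theorem integrable_prof₂ {α β : ℝ} (hα : -1 < α) (hs : α + β < -1) :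
    Integrable (fun z : Fin 2 → ℝ => prof₂ α β ‖z‖) := by
  refine (integrable_fun_norm_addHaar volume).mpr ?_
  have hdim : Module.finrank ℝ (Fin 2 → ℝ) - 1 = 1 := by simp
  rw [hdim, ← Ioc_union_Ioi_eq_Ioi zero_le_one, integrableOn_union]
  simp only [pow_one, smul_eq_mul]
  constructor
  · have h := (intervalIntegral.intervalIntegrable_rpow' hα (a := 0) (b := 1)).const_mul 6
    rw [intervalIntegrable_iff_integrableOn_Ioc_of_le zero_le_one] at h
    refine h.congr_fun (fun y hy => ?_) measurableSet_Ioc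
    show 6 * y ^ α = y * prof₂ α β y
    have hy0 : y ≠ 0 := hy.1.ne'
    rw [prof₂, if_pos hy.2, Real.rpow_sub_one hy0, mul_div_assoc' 6, mul_div_cancel₀ _ hy0]
  · have h : IntegrableOn (fun y : ℝ => 6 * y ^ (α + β)) (Ioi 1) :=
      (integrableOn_Ioi_rpow_of_lt hs zero_lt_one).const_mul 6
    refine h.congr_fun (fun y hy => ?_) measurableSet_Ioi
    have hy1 : (1 : ℝ) < y := hy
    have hy0 : y ≠ 0 := by linarith
    show 6 * y ^ (α + β) = y * prof₂ α β y
    rw [prof₂, if_neg (not_le.mpr hy1), Real.rpow_sub_one hy0, mul_div_assoc' 6,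
      mul_div_cancel₀ _ hy0]

/-! ## Integrability of `h = Re g'` on the half-plane -/

/-- `Re g_{αβ}'(x+iy)` is continuous on `D`. -/
theorem continuousOn_re_gTwoDer (α β : ℝ) :
    ContinuousOn (fun z : Fin 2 → ℝ => (gTwoDer α β ((z 0 : ℂ) + z 1 * I)).re) Dom := by
  intro z hz
  have hs := mem_slitPlane_pair (x := z 0) hz.2
  have hlin : Continuous fun w : Fin 2 → ℝ => (w 0 : ℂ) + w 1 * I := by fun_prop
  have h := (continuousAt_gTwoDer α β hs.1 hs.2).comp
    (f := fun w : Fin 2 → ℝ => (w 0 : ℂ) + w 1 * I) hlin.continuousAt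
  exact (Complex.continuous_re.continuousAt.comp h).continuousWithinAt

/-- **`Re g_{αβ}'` is absolutely integrable on `D`** for `-1 < α ≤ 0`, `-1 ≤ β ≤ 0`,
`α + β < -1`. -/
theorem integrableOn_re_gTwoDer {α β : ℝ} (hα : -1 < α) (hα0 : α ≤ 0) (hβ : -1 ≤ β) (hβ0 : β ≤ 0)
    (hs : α + β < -1) :
    IntegrableOn (fun z : Fin 2 → ℝ => (gTwoDer α β ((z 0 : ℂ) + z 1 * I)).re) Dom := by
  refine Integrable.mono' (integrable_prof₂ hα hs).integrableOn
    ((continuousOn_re_gTwoDer α β).aestronglyMeasurable isOpen_Dom.measurableSet) ?_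
  refine (ae_restrict_iff' isOpen_Dom.measurableSet).mpr (Eventually.of_forall fun z hz => ?_)
  rw [Real.norm_eq_abs]
  exact (abs_re_le_norm _).trans (norm_gTwoDer_le_prof₂ hα.le hα0 hβ hβ0 hz.1 hz.2)

end SoloBlind

end Summit.KontsevichZagierPeriods.KontsevichZagierPeriods.Theorems
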